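import Mathlib
import Summits.Ventures.DiscreteObjects.Mahler.QuarticCensusRow
import Summits.Ventures.DiscreteObjects.Mahler.SmallMeasureReciprocal

/-!
# All integer polynomials of degree `≤ 5`: `M = 1`, `M = θ₀`, or `M ≥ 1.3248` (venture `DiscreteObjects`, target L)

Cell `pub-namedobj`, seat `pub-namedobj-mahler` (gen 10). Framing: lottery ticket; floor = certified
bounds/negative ranges.

From the irreducible rows (`degreeCensus_two_empty`, `degreeCensus_four`, `reciprocal_or_smyth_of_measure_lt`)
and multiplicativity of the Mahler measure over a factorisation into irreducibles: for EVERY `p ∈ ℤ[X]`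
(reducible or not) of degree `≤ 5` with `1 < M(p) < 1.3248`, one has `M(p) = θ₀ = 1.3247…` (a Smyth cubic
times cyclotomic/monomial factors).  Hence the cell's census rows in the engines' own format
`HeightBoundedCensus n h B L` are EMPTY for every `n ≤ 5`, every height `h` and every `B ≤ θ₀` — in
particular for the table's bound `B = 1.3` — certified in the kernel with zero compute.

* `intMahlerMeasure_multiset_prod` — `M(∏ F) = ∏ M(f)`;
* `measure_irreducible_factor_le_five` — irreducible `f`, `deg f ≤ 5`: `M(f) = 1 ∨ M(f) = θ₀ ∨ M(f) ≥ 1.3248`;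
* `intMahlerMeasure_eq_smythTheta_of_natDegree_le_five` — `deg p ≤ 5`, `1 < M(p) < 1.3248` ⇒ `M(p) = θ₀`;
* `heightBoundedCensus_of_le_five` — `HeightBoundedCensus n h B []` for `n ≤ 5`, `B ≤ θ₀`;
  `heightBoundedCensus_of_le_five_thirteen` — the table's bound `13/10`.
-/

namespace Summit.Ventures.DiscreteObjects.Mahler

open Polynomial

/-- `M(∏ F) = ∏_{f ∈ F} M(f)`. -/
theorem intMahlerMeasure_multiset_prod (F : Multiset ℤ[X]) :
    intMahlerMeasure F.prod = (F.map intMahlerMeasure).prod := by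
  induction F using Multiset.induction_on with
  | empty =>
    simp only [Multiset.prod_zero, Multiset.map_zero]
    unfold intMahlerMeasure
    rw [Polynomial.map_one, mahlerMeasure_one]
  | cons f F ih => rw [Multiset.prod_cons, Multiset.map_cons, Multiset.prod_cons, intMahlerMeasure_mul, ih]

/-- An irreducible integer polynomial of degree `≤ 5` has `M = 1`... more precisely `M ≤ 1`, or `M = θ₀`,
or `M ≥ 1.3248`. -/
theorem measure_irreducible_factor_le_five {f : ℤ[X]} (hirr : Irreducible f) (hdeg : f.natDegree ≤ 5) :
    intMahlerMeasure f ≤ 1 ∨ intMahlerMeasure f = smythTheta ∨ 13248 / 10000 ≤ intMahlerMeasure f := by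
  by_cases h1 : intMahlerMeasure f ≤ 1
  · exact Or.inl h1
  by_cases h2 : 13248 / 10000 ≤ intMahlerMeasure f
  · exact Or.inr (Or.inr h2)
  push Not at h1 h2
  right; left
  rcases reciprocal_or_smyth_of_measure_lt hirr h1 h2 with ⟨hrev, heven, hd2⟩ | ⟨hM, -⟩
  · -- palindromic of even degree `2` or `4`: excluded by the degree-2 and degree-4 rows
    exfalso
    obtain ⟨j, hj⟩ := heven
    rcases (by omega : f.natDegree = 2 ∨ f.natDegree = 4) with hd | hd
    · have hφ : (13248 : ℝ) / 10000 ≤ (1 + Real.sqrt 5) / 2 := by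
        have : (165 : ℝ) / 100 < Real.sqrt 5 := by
          rw [show (165 : ℝ) / 100 = Real.sqrt ((165/100)^2) by rw [Real.sqrt_sq (by norm_num)]]
          exact Real.sqrt_lt_sqrt (by norm_num) (by norm_num)
        linarith
      obtain ⟨l, hl, -⟩ := degreeCensus_two_empty (le_refl _) f hd hirr h1 (lt_of_lt_of_le h2 hφ)
      simp at hl
    · obtain ⟨l, hl, -⟩ := degreeCensus_four f hd hirr h1 h2
      simp at hl
  · exact hM

/-- A multiset of reals each `= 1` or `= θ₀` has product `θ₀^k`, `k` = number of entries `≠ 1`. -/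
theorem prod_eq_smythTheta_pow {G : Multiset ℝ} (hG : ∀ x ∈ G, x = 1 ∨ x = smythTheta) :
    G.prod = smythTheta ^ Multiset.card (G.filter fun x => x ≠ 1) := by
  induction G using Multiset.induction_on with
  | empty => simp
  | cons x G ih =>
    have hx := hG x (Multiset.mem_cons_self x G)
    rw [Multiset.prod_cons, ih (fun y hy => hG y (Multiset.mem_cons_of_mem hy)), Multiset.filter_cons]
    rcases hx with rfl | rfl
    · simp
    · have hθ1 : smythTheta ≠ 1 := by linarith [smythTheta_gt]
      rw [if_pos hθ1, Multiset.singleton_add, Multiset.card_cons, pow_succ, mul_comm]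

/-- **Degree `≤ 5`, any integer polynomial:** `1 < M(p) < 1.3248` forces `M(p) = θ₀`. -/
theorem intMahlerMeasure_eq_smythTheta_of_natDegree_le_five {p : ℤ[X]} (hdeg : p.natDegree ≤ 5)
    (h1 : 1 < intMahlerMeasure p) (h2 : intMahlerMeasure p < 13248 / 10000) :
    intMahlerMeasure p = smythTheta := by
  classical
  have hp : p ≠ 0 := by
    intro h
    rw [h] at h1
    unfold intMahlerMeasure at h1
    rw [Polynomial.map_zero, mahlerMeasure_zero] at h1
    linarith
  -- factorisation into irreducibles: `p = (∏ F) · u`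
  obtain ⟨u, hu⟩ := UniqueFactorizationMonoid.factors_prod hp
  obtain ⟨c, hc, hcu⟩ := Polynomial.isUnit_iff.mp u.isUnit
  set F := UniqueFactorizationMonoid.factors p with hF
  have hFirr : ∀ f ∈ F, Irreducible f := fun f hf => UniqueFactorizationMonoid.irreducible_of_factor f hf
  have hMu : intMahlerMeasure (↑u : ℤ[X]) = 1 := by
    rw [← hcu, intMahlerMeasure_C]
    rcases Int.isUnit_iff.mp hc with h | h <;> simp [h]
  have hMp : intMahlerMeasure p = (F.map intMahlerMeasure).prod := by
    rw [← hu, intMahlerMeasure_mul, hMu, mul_one, intMahlerMeasure_multiset_prod]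
  -- each factor: `M ∈ {1, θ₀}` (a factor `≥ 1.3248` would make the product too large)
  have hdvd : ∀ f ∈ F, f ∣ p := fun f hf => (Multiset.dvd_prod hf).trans ⟨↑u, hu.symm⟩
  have hge1 : ∀ x ∈ F.map intMahlerMeasure, 1 ≤ x := by
    intro x hx
    obtain ⟨f, hf, rfl⟩ := Multiset.mem_map.mp hx
    exact one_le_intMahlerMeasure (hFirr f hf).ne_zero
  have hprod_ge : ∀ x ∈ F.map intMahlerMeasure, x ≤ (F.map intMahlerMeasure).prod := by
    intro x hx
    obtain ⟨T, hT⟩ := Multiset.exists_cons_of_mem hx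
    rw [hT, Multiset.prod_cons]
    have hT1 : 1 ≤ T.prod := Multiset.one_le_prod (fun y hy => hge1 y (by rw [hT]; exact Multiset.mem_cons_of_mem hy))
    have hx0 : 0 ≤ x := le_trans zero_le_one (hge1 x hx)
    nlinarith
  have hvals : ∀ x ∈ F.map intMahlerMeasure, x = 1 ∨ x = smythTheta := by
    intro x hx
    obtain ⟨f, hf, rfl⟩ := Multiset.mem_map.mp hx
    have hfdeg : f.natDegree ≤ 5 := (natDegree_le_of_dvd (hdvd f hf) hp).trans hdeg
    rcases measure_irreducible_factor_le_five (hFirr f hf) hfdeg with h | h | h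
    · exact Or.inl (le_antisymm h (hge1 _ hx))
    · exact Or.inr h
    · exfalso
      have := hprod_ge _ hx
      rw [← hMp] at this
      linarith
  -- the product is `θ₀^k` with `1 < θ₀^k < 1.3248`, so `k = 1`
  have hpow := prod_eq_smythTheta_pow hvals
  rw [← hMp] at hpow
  set k := Multiset.card ((F.map intMahlerMeasure).filter fun x => x ≠ 1) with hk
  have hθ := smythTheta_gt
  have hθ' := smythTheta_lt
  rcases Nat.lt_trichotomy k 1 with hk0 | hk1 | hk2
  · have : k = 0 := by omega
    rw [this, pow_zero] at hpow
    linarith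
  · rw [hpow, hk1, pow_one]
  · have h3 : smythTheta ^ 2 ≤ smythTheta ^ k := pow_le_pow_right₀ (by linarith) hk2
    rw [← hpow] at h3
    nlinarith

/-- **No integer polynomial of degree `≤ 5` has Mahler measure in `(1, θ₀)`.** -/
theorem not_measure_lt_smythTheta_of_natDegree_le_five {p : ℤ[X]} (hdeg : p.natDegree ≤ 5)
    (h1 : 1 < intMahlerMeasure p) : smythTheta ≤ intMahlerMeasure p := by
  by_contra h
  push Not at h
  have := intMahlerMeasure_eq_smythTheta_of_natDegree_le_five hdeg h1 (lt_trans h smythTheta_lt)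
  linarith

/-- **Census rows in the engines' format, degrees `≤ 5`:** `HeightBoundedCensus n h B []` for every
`n ≤ 5`, every height bound `h` and every `B ≤ θ₀`. -/
theorem heightBoundedCensus_of_le_five {n h : ℕ} (hn : n ≤ 5) {B : ℝ} (hB : B ≤ smythTheta) :
    HeightBoundedCensus n h B [] := by
  refine ⟨fun p hdeg _ h1 h2 => ?_, fun l hl => by simp at hl⟩
  exfalso
  have := not_measure_lt_smythTheta_of_natDegree_le_five (p := p) (by omega) h1
  linarith

/-- The table's bound `B = 13/10`: `HeightBoundedCensus n h (13/10) []` for all `n ≤ 5` and all `h`. -/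
theorem heightBoundedCensus_of_le_five_thirteen {n h : ℕ} (hn : n ≤ 5) :
    HeightBoundedCensus n h (13 / 10) [] :=
  heightBoundedCensus_of_le_five hn (by linarith [smythTheta_gt])

end Summit.Ventures.DiscreteObjects.Mahler
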